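import Summits.KontsevichZagierPeriods.KontsevichZagierPeriods.Theorems.RootDecompRationalCubeDichotomyRankDescentP03

/-! # `RootDecompRationalCubeDichotomyRankDescentP04` — part 4/14 of the mechanical ≤400-line split of `RankDescent_v12_landing.lean` (sha256 00885b8b9882f02e…)
Source: decomp-kz lens-2 g13 `RankDescent_v12.lean` (HOME/decomp-kz-lens-2/g13/, sha256 00885b8b…; critic g5-18…g5-66 CLEARED as NODE v1–v12 for crux stmt-KontsevichZagierPeriods-26322 RationalCubePiKernelSingle: rank dichotomy single_of_fullRankGeTwo + RankLeOneKernel, de Rham-exact descent, linear-in-one-variable / hyperbola / Fermat–hyperbolic / conic classes, transport kit, Brieskorn module; writer g7 l.1222: «landing split §0–4 ∣ … ∣ §16 --supports 26322 endorsed»); `#print axioms` pins removed; landed by census-1 g9.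
Split by census-1 g9 `gen/splitlean.py`: scopes re-opened with their `open`/`variable`/`set_option` context; mathematics and declaration order unchanged. -/

noncomputable section
open MeasureTheory Set MvPolynomial
open Literature.NumberTheory.Transcendental
open Literature.NumberTheory.Transcendental.KZ
namespace Summit.KontsevichZagierPeriods.RootDecompRationalCubeDichotomy.Rung26322.RankDescent
variable {M : ℕ}

open MeasureTheory Set MvPolynomial in
open Literature.NumberTheory.Transcendental in
open Literature.NumberTheory.Transcendental.KZ in
/-- Any rational-shape representation of dimension `≤ 1` with value `0` is `≡ 0`. [cite: KontsevichZagier2001, §1.2] -/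
private theorem mem_relations_of_dim_le_one {n : ℕ} (hn : n ≤ 1) (q : IntegralRep n) (hq : q.IsRational)
    (h0 : q.value = 0) : of q ∈ relations := by
  have hZ := RFun.rel_of_eqOn_zero (T := (RFun.const 0 : RFun n)) fun x _ => by simp
  have hE : KZ.Equivalent q (RFun.const 0 : RFun n).rep :=
    Summit.KontsevichZagierPeriods.LowDimension.LowdimBaker0DimLeOne.lowdimBaker0DimLeOne_proof hn hn
      q (RFun.const 0 : RFun n).rep hq (isRational_rep _) (by rw [h0, value_const_zero])
  have : of q = (of q - of (RFun.const 0 : RFun n).rep) + of (RFun.const 0 : RFun n).rep := by abel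
  rw [this]
  exact KZ.relations.add_mem hE hZ

open MeasureTheory Set MvPolynomial in
open Literature.NumberTheory.Transcendental in
open Literature.NumberTheory.Transcendental.KZ in
/-- Soundness: congruent formal combinations have equal values. [cite: KontsevichZagier2001, §1.2] -/
private theorem eval_eq_of_sub_mem {x y : FormalRep} (h : x - y ∈ relations) : eval x = eval y := by
  have h' := relations_le_ker_eval_holds h
  rw [AddMonoidHom.mem_ker, map_sub] at h'
  exact sub_eq_zero.1 h'

/-- 26322 AT dimension `m` (its body with `m` fixed). [cite: KontsevichZagier2001, §1.2] -/
def SingleAt (m : ℕ) : Prop :=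
  ∀ (q : IntegralRep m) (P Q : MvPolynomial (Fin m) ℚ),
    q.domain = Set.pi Set.univ (fun _ : Fin m => Set.Icc (0:ℝ) 1) →
    (∀ z ∈ Set.pi Set.univ (fun _ : Fin m => Set.Icc (0:ℝ) 1), MvPolynomial.aeval z Q ≠ 0) →
    (∀ z ∈ Set.pi Set.univ (fun _ : Fin m => Set.Icc (0:ℝ) 1),
      q.integrand z = MvPolynomial.aeval z P / MvPolynomial.aeval z Q) →
    q.value = 0 → ∃ N : ℕ, (fun y : FormalRep => of piRep * y)^[N] (of q) ∈ relations

/-- 26322 is the conjunction of its dimension slices. [folklore] -/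
theorem single_iff_forall_singleAt :
    Summit.KontsevichZagierPeriods.KontsevichZagierPeriods.Theses.RootDecompRationalCubeDichotomy.RationalCubePiKernelSingle
      ↔ ∀ m, SingleAt m :=
  ⟨fun h m => h m, fun h m => h m⟩

/-- **GENERIC PIECE at dimension `m` (v2 residual slice): `NonExactAt m`.** 26322 at dimension `m`
restricted to NON-EXACT data: no `s, G_1..G_m ∈ ℚ[x]` with
`P · Q^{s+1} = Σ_k (∂_k G_k · Q − (s+1) G_k ∂_k Q)` (the class of `P/Q·dx` in `H^m_dR(𝔸^m_ℚ ∖ {Q=0})`,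
computed by forms with poles along `Q`, is non-zero). [cite: KontsevichZagier2001, §1.2] -/
def NonExactAt (m : ℕ) : Prop :=
  ∀ (q : IntegralRep m) (P Q : MvPolynomial (Fin m) ℚ),
    (¬ ∃ (s : ℕ) (G : Fin m → MvPolynomial (Fin m) ℚ),
      P * Q ^ (s + 1) = ∑ k, (MvPolynomial.pderiv k (G k) * Q - C ((s : ℚ) + 1) * (G k * MvPolynomial.pderiv k Q))) →
    q.domain = Set.pi Set.univ (fun _ : Fin m => Set.Icc (0:ℝ) 1) →
    (∀ z ∈ Set.pi Set.univ (fun _ : Fin m => Set.Icc (0:ℝ) 1), MvPolynomial.aeval z Q ≠ 0) →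
    (∀ z ∈ Set.pi Set.univ (fun _ : Fin m => Set.Icc (0:ℝ) 1),
      q.integrand z = MvPolynomial.aeval z P / MvPolynomial.aeval z Q) →
    q.value = 0 → ∃ N : ℕ, (fun y : FormalRep => of piRep * y)^[N] (of q) ∈ relations

/-- `SingleAt m → NonExactAt m` (drop the hypothesis). [folklore] -/
theorem nonExactAt_of_singleAt {m : ℕ} (h : SingleAt m) : NonExactAt m :=
  fun q P Q _ hd hQ hf h0 => h q P Q hd hQ hf h0

/-- Dimensions `≤ 1` are decided outright (Baker, `KZ_≤1` in the tree), `N = 0`. [cite: KontsevichZagier2001, §1.2] -/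
theorem singleAt_of_le_one {m : ℕ} (hm : m ≤ 1) : SingleAt m :=
  fun q P Q hd hQ hf h0 => ⟨0, mem_relations_of_dim_le_one hm q (isRational_of_hyps q P Q hd hQ hf) h0⟩

/-- **Exact reduct (PROVED).** Exact data `(q, P, Q, s, G)` on `[0,1]^{m+1}` are congruent to ONE
regular rational cube representation on `[0,1]^m` (merge of the `2(m+1)` face terms). [cite: KontsevichZagier2001, §1.2 rules (1),(3)] -/
theorem exact_reduct {m : ℕ} (q : IntegralRep (m + 1)) (P Q : MvPolynomial (Fin (m + 1)) ℚ) (s : ℕ)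
    (G : Fin (m + 1) → MvPolynomial (Fin (m + 1)) ℚ)
    (hid : P * Q ^ (s + 1) =
      ∑ k, (MvPolynomial.pderiv k (G k) * Q - C ((s : ℚ) + 1) * (G k * MvPolynomial.pderiv k Q)))
    (hd : q.domain = Set.pi Set.univ (fun _ : Fin (m + 1) => Set.Icc (0:ℝ) 1))
    (hQ : ∀ z ∈ Set.pi Set.univ (fun _ : Fin (m + 1) => Set.Icc (0:ℝ) 1), MvPolynomial.aeval z Q ≠ 0)
    (hf : ∀ z ∈ Set.pi Set.univ (fun _ : Fin (m + 1) => Set.Icc (0:ℝ) 1),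
      q.integrand z = MvPolynomial.aeval z P / MvPolynomial.aeval z Q) :
    ∃ U : RFun m, of q - KZ.of U.rep ∈ relations := by
  set T : RFun (m + 1) := cubeRFun P Q hQ with hTdef
  have hrel := descent_rel_exact T s G hid
  set A : Fin (m + 1) → RFun m := fun k => (Wp T s (G k)).faceAt k 1 zero_le_one_and with hA
  set B : Fin (m + 1) → RFun m := fun k => (Wp T s (G k)).faceAt k 0 le_rfl_and with hB
  set L : List (RFun m) := (List.ofFn A) ++ List.ofFn fun k => (B k).neg with hL
  have hU := rel_lsum L
  have hLsum : (L.map fun S => KZ.of S.rep).sum = ∑ k, KZ.of (A k).rep + ∑ k, KZ.of (B k).neg.rep := by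
    rw [hL, List.map_append, List.sum_append, List.map_ofFn, List.sum_ofFn, List.map_ofFn, List.sum_ofFn]
    rfl
  have hneg : ∀ k, KZ.of (B k).neg.rep + KZ.of (B k).rep ∈ KZ.relations := fun k => RFun.rel_neg _
  have hrel' : KZ.of T.rep - ∑ k, (KZ.of (A k).rep - KZ.of (B k).rep) ∈ KZ.relations := hrel
  have hTU : KZ.of T.rep - KZ.of (lsum L).rep ∈ KZ.relations := by
    have : KZ.of T.rep - KZ.of (lsum L).rep =
        (KZ.of T.rep - ∑ k, (KZ.of (A k).rep - KZ.of (B k).rep)) -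
        (KZ.of (lsum L).rep - (L.map fun S => KZ.of S.rep).sum) -
        ∑ k, (KZ.of (B k).neg.rep + KZ.of (B k).rep) := by
      rw [hLsum]; simp only [Finset.sum_add_distrib, Finset.sum_sub_distrib]; abel
    rw [this]
    exact sub_mem (sub_mem hrel' hU) (sum_mem fun k _ => hneg k)
  have hqT := of_sub_cubeRFun_mem q P Q hd hQ hf
  refine ⟨lsum L, ?_⟩
  have : of q - KZ.of (lsum L).rep = (of q - KZ.of T.rep) + (KZ.of T.rep - KZ.of (lsum L).rep) := by abel
  rw [this]
  exact add_mem hqT hTU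

/-- **The exact-descent step (PROVED)**: exact data at dimension `m+1` reduce to 26322 at dimension `m`,
non-exact data are the residual slice. [cite: KontsevichZagier2001, §1.2 rules (1),(3)] -/
theorem singleAt_succ {m : ℕ} (ih : SingleAt m) (hne : NonExactAt (m + 1)) : SingleAt (m + 1) := by
  intro q P Q hd hQ hf h0
  by_cases hex : ∃ (s : ℕ) (G : Fin (m + 1) → MvPolynomial (Fin (m + 1)) ℚ),
      P * Q ^ (s + 1) = ∑ k, (MvPolynomial.pderiv k (G k) * Q - C ((s : ℚ) + 1) * (G k * MvPolynomial.pderiv k Q))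
  swap
  · exact hne q P Q hex hd hQ hf h0
  obtain ⟨s, G, hid⟩ := hex
  obtain ⟨U, hqU⟩ := exact_reduct q P Q s G hid hd hQ hf
  have hval : U.rep.value = 0 := by
    rw [← eval_of, ← eval_eq_of_sub_mem hqU, eval_of, h0]
  obtain ⟨N, hN⟩ := ih U.rep U.num U.den (by rw [RFun.rep_domain, KZ.cube_eq_pi])
    (fun z hz => U.den_ne z (by rw [KZ.cube_eq_pi]; exact hz)) (fun z _ => rfl) hval
  refine ⟨N, ?_⟩
  have : of q = (of q - KZ.of U.rep) + KZ.of U.rep := by abel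
  rw [this, iterate_piMul_add]
  exact add_mem (piRep_mul_iterate_mem_relations N hqU) hN

/-- **Corollary (PROVED, N = 0): exact integrands on the SQUARE.** A rational representation
`[ [0,1]^2, P/Q ]` whose form `P/Q dx∧dy` is exact in `ℚ[x,y,1/Q]` and whose value is `0` is `≡ 0`
— for each zero-free `Q` this decides a ℚ-subspace of numerators `P` of finite codimension
(`≤ dim H²_dR(𝔸² ∖ {Q=0})`, Grothendieck). [cite: KontsevichZagier2001, §1.2] -/
theorem mem_relations_of_exact_two (q : IntegralRep 2) (P Q : MvPolynomial (Fin 2) ℚ) (s : ℕ)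
    (G : Fin 2 → MvPolynomial (Fin 2) ℚ)
    (hid : P * Q ^ (s + 1) =
      ∑ k, (MvPolynomial.pderiv k (G k) * Q - C ((s : ℚ) + 1) * (G k * MvPolynomial.pderiv k Q)))
    (hd : q.domain = Set.pi Set.univ (fun _ : Fin 2 => Set.Icc (0:ℝ) 1))
    (hQ : ∀ z ∈ Set.pi Set.univ (fun _ : Fin 2 => Set.Icc (0:ℝ) 1), MvPolynomial.aeval z Q ≠ 0)
    (hf : ∀ z ∈ Set.pi Set.univ (fun _ : Fin 2 => Set.Icc (0:ℝ) 1),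
      q.integrand z = MvPolynomial.aeval z P / MvPolynomial.aeval z Q)
    (h0 : q.value = 0) : of q ∈ relations := by
  obtain ⟨U, hqU⟩ := exact_reduct (m := 1) q P Q s G hid hd hQ hf
  have hval : U.rep.value = 0 := by
    rw [← eval_of, ← eval_eq_of_sub_mem hqU, eval_of, h0]
  have hU := rep_mem_relations_of_dim_le_one le_rfl U hval
  have : of q = (of q - KZ.of U.rep) + KZ.of U.rep := by abel
  rw [this]
  exact add_mem hqU hU

/-- **Theorem III (graded exhaustion, PROVED).** 26322 up to dimension `M` ⟸ the non-exact slices in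
dimensions `2 … M`. [cite: KontsevichZagier2001, §1.2] -/
theorem singleAt_of_nonExactAt_le (M : ℕ) (h : ∀ m, 2 ≤ m → m ≤ M → NonExactAt m) :
    ∀ m, m ≤ M → SingleAt m := by
  intro m
  induction m with
  | zero => intro _; exact singleAt_of_le_one (Nat.zero_le 1)
  | succ m ih =>
    intro hmM
    by_cases hm : m + 1 ≤ 1
    · exact singleAt_of_le_one hm
    · exact singleAt_succ (ih (by omega)) (h (m + 1) (by omega) hmM)

/-- **GENERIC PIECE (v2, ungraded): `NonExactKernelGeTwo`** := all non-exact slices from dimension 2 on.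
(source: KontsevichZagier2001, §1.2) -/
def NonExactKernelGeTwo : Prop := ∀ m, 2 ≤ m → NonExactAt m

/-- **Theorem III' (PROVED): the non-exact residual implies crux 26322 (by name).** -/
theorem single_of_nonExactGeTwo (h : NonExactKernelGeTwo) :
    Summit.KontsevichZagierPeriods.KontsevichZagierPeriods.Theses.RootDecompRationalCubeDichotomy.RationalCubePiKernelSingle :=
  single_iff_forall_singleAt.2 fun m =>
    singleAt_of_nonExactAt_le m (fun k hk _ => h k hk) m le_rfl

/-- The v2 residual is implied by the crux (drop hypotheses). [folklore] -/
theorem nonExactKernelGeTwo_of_single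
    (h : Summit.KontsevichZagierPeriods.KontsevichZagierPeriods.Theses.RootDecompRationalCubeDichotomy.RationalCubePiKernelSingle) :
    NonExactKernelGeTwo :=
  fun m _ => nonExactAt_of_singleAt (single_iff_forall_singleAt.1 h m)

/-- The v2 residual is implied by the v1 residual: non-exact data have full rank, so
`NonExactKernelGeTwo` is the SMALLER family. [folklore] -/
theorem nonExactKernelGeTwo_of_fullRank (h : FullRankKernelGeTwo) : NonExactKernelGeTwo := by
  intro m hm q P Q hnex hd hQ hf h0
  exact h m q P Q hm (fun v hv => fullRank_of_not_drExact hnex v hv) hd hQ hf h0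

/-! ### Instrumenting the bottom generic slices by the `m ≤ 2` programme (edge by name) -/

/-- `HodgeLevel.DimTwoRationalStratum` (item 0096: Conjecture 1 for rational representations of
dimensions `≤ 2`) decides every slice `SingleAt m`, `m ≤ 2`, with `N = 0`. [cite: KontsevichZagier2001, §1.2] -/
theorem singleAt_of_dimTwoRationalStratum
    (h : Summit.KontsevichZagierPeriods.KontsevichZagierPeriods.Theses.HodgeLevel.DimTwoRationalStratum)
    {m : ℕ} (hm : m ≤ 2) : SingleAt m := by
  intro q P Q hd hQ hf h0
  refine ⟨0, ?_⟩
  have hZ := RFun.rel_of_eqOn_zero (T := (RFun.const 0 : RFun m)) fun x _ => by simp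
  have hE : KZ.Equivalent q (RFun.const 0 : RFun m).rep :=
    h hm hm q (RFun.const 0 : RFun m).rep (isRational_of_hyps q P Q hd hQ hf) (isRational_rep _)
      (by rw [h0, value_const_zero])
  have : of q = (of q - of (RFun.const 0 : RFun m).rep) + of (RFun.const 0 : RFun m).rep := by abel
  show of q ∈ relations
  rw [this]
  exact KZ.relations.add_mem hE hZ

/-- **Corollary (PROVED): 26322 up to dimension 3 ⟸ the `m ≤ 2` programme ∧ the single slice
`NonExactAt 3`** — the first generic layer beyond the cell's `m = 2` engines is exactly the NON-EXACT
rational 3-cube integrands with value 0. [cite: KontsevichZagier2001, §1.2] -/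
theorem singleAt_le_three_of
    (h2 : Summit.KontsevichZagierPeriods.KontsevichZagierPeriods.Theses.HodgeLevel.DimTwoRationalStratum)
    (h3 : NonExactAt 3) : ∀ m, m ≤ 3 → SingleAt m := by
  intro m hm
  by_cases hm3 : m = 3
  · subst hm3
    exact singleAt_succ (singleAt_of_dimTwoRationalStratum h2 le_rfl) h3
  · exact singleAt_of_dimTwoRationalStratum h2 (by omega)

/-! ### A witness separating v2 from v1: exact, full-rank, dimension 2

`[ [0,1]², (1 − 2x − x² + y² − 2xy²)/(1+x²+y²)² ]`: the form is `∂_x ( x(1−x)/(1+x²+y²) ) dx∧dy`, so it is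
exact (`s = 0`, `G = (x(1−x)(1+x²+y²), 0)` relative to the denominator `(1+x²+y²)²`) and its value is `0`
(the boundary terms at `x = 0, 1` vanish); the denominator has FULL rank, so v1 (`RankLeOneKernel`,
rank descent) does not touch it, while `mem_relations_of_exact_two` decides it with `N = 0`. -/

/-- Numerator of the witness. [folklore] -/
def witnessP : MvPolynomial (Fin 2) ℚ := 1 - 2 * X 0 - X 0 ^ 2 + X 1 ^ 2 - 2 * X 0 * X 1 ^ 2

/-- Denominator of the witness. [folklore] -/
def witnessQ : MvPolynomial (Fin 2) ℚ := (1 + X 0 ^ 2 + X 1 ^ 2) ^ 2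

/-- Potential of the witness. [folklore] -/
def witnessG : Fin 2 → MvPolynomial (Fin 2) ℚ := ![X 0 * (1 - X 0) * (1 + X 0 ^ 2 + X 1 ^ 2), 0]

/-- Auxiliary step `pderiv_one_X_zero`: pderiv one X zero. [bookkeeping] -/
theorem pderiv_one_X_zero : (pderiv 1 : MvPolynomial (Fin 2) ℚ → MvPolynomial (Fin 2) ℚ) (X 0) = 0 :=
  pderiv_X_of_ne (by decide)

/-- Auxiliary step `pderiv_zero_X_one`: pderiv zero X one. [bookkeeping] -/
theorem pderiv_zero_X_one : (pderiv 0 : MvPolynomial (Fin 2) ℚ → MvPolynomial (Fin 2) ℚ) (X 1) = 0 :=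
  pderiv_X_of_ne (by decide)

/-- The witness is exact: `P · Q^1 = Σ_k (∂_k G_k · Q − 1 · G_k ∂_k Q)`. [folklore] -/
theorem witness_exact : witnessP * witnessQ ^ (0 + 1) =
    ∑ k, (MvPolynomial.pderiv k (witnessG k) * witnessQ -
      C (((0 : ℕ) : ℚ) + 1) * (witnessG k * MvPolynomial.pderiv k witnessQ)) := by
  simp only [witnessP, witnessQ, witnessG, Fin.sum_univ_two, Matrix.cons_val_zero, Matrix.cons_val_one,
    Nat.cast_zero, zero_add, one_mul, zero_mul, mul_zero, sub_zero, add_zero, map_zero,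
    Derivation.leibniz, Derivation.leibniz_pow, map_add, map_sub, map_one, pderiv_X_self,
    pderiv_one_X_zero, pderiv_zero_X_one, smul_eq_mul, nsmul_eq_mul, Derivation.map_one_eq_zero]
  ring

/-- Auxiliary step `witness_drExact`: witness dr Exact. [bookkeeping] -/
theorem witness_drExact : DRExact witnessP witnessQ := ⟨0, witnessG, witness_exact⟩

/-- The witness denominator has full rank (so v1 does not apply to it). [folklore] -/
theorem witness_fullRank (v : Fin 2 → ℚ) (hv : (∑ k, v k • MvPolynomial.pderiv k witnessQ) = 0) :
    v = 0 := by
  have hQ : (1 + X 0 ^ 2 + X 1 ^ 2 : MvPolynomial (Fin 2) ℚ) ≠ 0 := by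
    intro h
    have := congrArg constantCoeff h
    simp at this
  have hsum : (∑ k, v k • MvPolynomial.pderiv k witnessQ) =
      (1 + X 0 ^ 2 + X 1 ^ 2) * (C (4 * v 0) * X 0 + C (4 * v 1) * X 1) := by
    simp only [witnessQ, Fin.sum_univ_two, Derivation.leibniz_pow, map_add, Derivation.map_one_eq_zero,
      pderiv_X_self, pderiv_one_X_zero, pderiv_zero_X_one, smul_eq_mul, nsmul_eq_mul,
      MvPolynomial.smul_eq_C_mul, map_mul, map_ofNat, zero_add, add_zero, mul_one, mul_zero, Nat.cast_ofNat]
    ring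
  rw [hsum] at hv
  have hlin : C (4 * v 0) * X 0 + C (4 * v 1) * X 1 = (0 : MvPolynomial (Fin 2) ℚ) :=
    (mul_eq_zero.1 hv).resolve_left hQ
  have h0 : v 0 = 0 := by
    have := congrArg (MvPolynomial.eval (fun i : Fin 2 => if i = 0 then (1:ℚ) else 0)) hlin
    simpa using this
  have h1 : v 1 = 0 := by
    have := congrArg (MvPolynomial.eval (fun i : Fin 2 => if i = 1 then (1:ℚ) else 0)) hlin
    simpa using this
  funext i
  fin_cases i
  · exact h0
  · exact h1

/-- The witness denominator is zero-free on the square (indeed positive on `ℝ²`). [folklore] -/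
theorem witness_zeroFree (z : Fin 2 → ℝ) (_hz : z ∈ Set.pi Set.univ (fun _ : Fin 2 => Set.Icc (0:ℝ) 1)) :
    MvPolynomial.aeval z witnessQ ≠ 0 := by
  simp only [witnessQ, map_pow, map_add, map_one, MvPolynomial.aeval_X]
  positivity

/-- **Witness decided (PROVED, N = 0).** Every representation with the witness data and value `0`
is `≡ 0`; it lies outside v1's decided family (full rank) and outside `KZ_≤1`. [cite: KontsevichZagier2001, §1.2] -/
theorem witness_decided (q : IntegralRep 2)
    (hd : q.domain = Set.pi Set.univ (fun _ : Fin 2 => Set.Icc (0:ℝ) 1))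
    (hf : ∀ z ∈ Set.pi Set.univ (fun _ : Fin 2 => Set.Icc (0:ℝ) 1),
      q.integrand z = MvPolynomial.aeval z witnessP / MvPolynomial.aeval z witnessQ)
    (h0 : q.value = 0) : of q ∈ relations :=
  mem_relations_of_exact_two q witnessP witnessQ 0 witnessG witness_exact hd witness_zeroFree hf h0

/-! ## §6 (v3) A DECIDED CLASS through v2: denominators LINEAR IN ONE VARIABLE

If `Q = c·x₀ + A(x₁,…,x_n)` (`c ∈ ℚˣ`, `A` free of `x₀`, `n ≥ 1`), then `𝔸^{n+1} ∖ {Q = 0} ≅ 𝔸ⁿ × 𝔾_m`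
has no `H^{n+1}`, and indeed EVERY `P/Q` is exact, constructively: divide `P = Q·q + ρ` with `ρ` free
of `x₀`; pick `∂₀G₀ = q` and, for some other variable `x_i`, `∂_iΦ = ρ` with `Φ` free of `x₀`; then
`P/Q = ∂₀(G₀ − Φ·∂_iA/Q) + ∂_i(Φ/Q)` (for `c = 1`; general `c` by rescaling `P, Q ↦ P/c, Q/c`, the same
integrand). Hence (v2) every such instance of 26322 at dimension `n+1` reduces to dimension `n`, and at
`n + 1 = 2` it is DECIDED with `N = 0`: `[ [0,1]², P(x,y)/(c·x + A(y)) ]`, value `0` ⟹ `∈ relations`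
(`linearVar_two_mem_relations`). These denominators have FULL rank as soon as `A` is non-affine
(e.g. `x + 2 + y²`), so the class is outside v1; it is not a hyperplane arrangement (LinRed routes) and
not the `Λ`-sector of lens-2 g6 (`1 + x·y·E(y)`, leading coefficient non-constant). -/

/-- `∂_k`-antiderivatives exist in `ℚ[x]`. [folklore] -/
private theorem exists_pderiv_eq (k : Fin M) (P : MvPolynomial (Fin M) ℚ) :
    ∃ G : MvPolynomial (Fin M) ℚ, pderiv k G = P := by
  have hv : (Pi.single k (1:ℚ) : Fin M → ℚ) ≠ 0 := by
    intro h
    have := congrFun h k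
    simp at this
  obtain ⟨G, hG⟩ := exists_dirD_eq (Pi.single k (1:ℚ)) hv P
  refine ⟨G, ?_⟩
  have hs : (∑ j, (Pi.single k (1:ℚ) : Fin M → ℚ) j • (pderiv j G : MvPolynomial (Fin M) ℚ)) = pderiv k G := by
    rw [Finset.sum_eq_single k (fun j _ hj => by simp [hj])
      (fun h => (h (Finset.mem_univ k)).elim)]
    simp
  rw [dirD_apply, hs] at hG
  exact hG

/-- `∂₀` kills polynomials in the other variables. [folklore] -/
theorem pderiv_zero_rename_succ {n : ℕ} (F : MvPolynomial (Fin n) ℚ) :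
    pderiv 0 (rename Fin.succ F) = 0 := by
  induction F using MvPolynomial.induction_on with
  | C a => simp
  | add p q hp hq => simp [hp, hq]
  | mul_X p j hp =>
    rw [map_mul, rename_X, Derivation.leibniz, hp, pderiv_X_of_ne (Fin.succ_ne_zero j), smul_zero,
      smul_zero, add_zero]

end Summit.KontsevichZagierPeriods.RootDecompRationalCubeDichotomy.Rung26322.RankDescent
end
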